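import Mathlib
import Literature.MathematicalPhysics.QuantumFieldTheory.Balaban1983to89.T4BetaMemory

/-!
# T4BetaMemorySharp — the SHARP rate of the forward renewal inequality of `T4BetaMemory` (row T4-U2.R of the
uniqueness spine; state form, exact impulse response, extremal data); kernel bookkeeping, nothing asserted

Cell pub-balaban (Bałaban YM₄ UV-stability reconstruction), near-miss cell 7, T4 node DAG (`t4/T4-DAG.md` v2 §5 row
T4-U2.R, owner unit b2b-balaban-pv20 — tree `T4BetaMemory`, p179498).  Unit b2b-balaban-b12 (PAPER SUB-CELL B12, gen 6),
journal item B12-HISTORY-CHANNELS; the B12-side locus census that goes with this module is the cell record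
`b2b-balaban-b12-g6/B12-XREAD-HISTORY.md` (where the preceding couplings enter (2.13) of [I]; the VALUE-level
irrelevance loci of [I] §§3–5; the linearity of β in the new term; the per-unit-volume weight of (0.30)).  Written at
the invitation of the row owner (journal NOTE pv20-g3 → b12-g6, 2026-08-18T21:09:26Z: "(a) SHARPNESS of the majorant
for general ω < 1 … I only typed the ω = 1 equality witness").  VALUE = kernel-checked bookkeeping complementary to
`T4BetaMemory`, STRICTLY DISJOINT from it (no renewal inequality is re-landed); NOT an estimate on Bałaban's objects,
NOT summit progress.

HONEST FRAMING (T4-DAG PAGE 1).  The cell's T4 target is rung (B)+1 — existence AND uniqueness of the ε → 0 limit of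
Bałaban's unit-scale averaged expectations on a FIXED finite torus; NOT infinite volume, NOT a mass gap, NOT the Clay
problem.  `T4BetaMemory` reduces node U2's two UNPRINTED structural inputs — `T4CouplingMatching.FadingMemory` of the
history moduli and `T4CouplingMatching.RemainderShiftRate` — to one-step inputs by a forward renewal inequality
`s_j ≤ a ρ^j + Σ_{i<j} M_{j,i} s_i` with functional memory `0 ≤ M_{j,i} ≤ C ω^{j−i}`, concluding a rate `ρ` for every
`ρ > (1 + C)ω` with a constant `a(ρ − ω)(ρ − (1 + C)ω)⁻¹` that blows up as `ρ ↓ (1 + C)ω`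
(`T4BetaMemory.renewal_geometric`, `moduli_geometric`, `fadingMemory_of_moduliRenewal`), and showing by the `ω = 1`
equality witness `constMemory_witness` that without contraction nothing follows.  THIS MODULE adds:

* §1 STATE FORM.  `acc ρ b n = Σ_{m<n} ρ^{n−1−m} b m`, the accumulated weighted content, obeys the first-order recursion
  `acc ρ b (n+1) = ρ · acc ρ b n + b n` (`acc_succ`): ageing by one factor `ρ` per step plus the newborn entry with
  weight `ρ⁰ = 1`.  Dictionary ([I] (0.30) p. 258, read on the render: *"= Σ_{j=1}^{k} O(1)(L^jη)^α M^{−4}|T₁^{(k)}| ≤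
  O(1)(1 − L^{−α})^{−1} M^{−4}|T₁^{(k)}|"*): per unit volume of the current lattice the irrelevant content of the
  scale-j terms weighs `(L^jη)^α`, one factor `ρ = L^{−α}` per unit of age `k − j` — the per-unit-VOLUME weight, not the
  per-block `L^{−(4+α)}` (cell GAPS G-t4-U3-6 counts blocks); (0.30)'s own `(1 − L^{−α})^{−1}` is `Σ_{ages} ρ^a`.
* §1 EXACT IMPULSE RESPONSE.  `impulse_le`: `s 0 ≤ 0`, `s (n+1) ≤ ρ s n + b n`, `b 0 ≤ d`, `b (n+1) ≤ c · s (n+1)`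
  (`ρ, c, d ≥ 0`) ⟹ `b n ≤ d (ρ + c)^n` — rate EXACTLY `ρ + c`, constant `d`, NO smallness hypothesis and no auxiliary
  target rate; `impulse_sharp`: with equalities `b (n+1) = c d (ρ + c)^n` — the rate `ρ + c` is attained.  In
  `T4BetaMemory`'s normalisation (`M_{j,i} ≤ C ω^{j−i}`, newest old entry weighted `C ω`): `ρ ↔ ω`, `c ↔ C ω`,
  `ρ + c ↔ (1 + C) ω`.  `renewal_le`: the exact resolvent for a general forcing,
  `b n ≤ f n + c Σ_{m<n} (ρ + c)^{n−1−m} f m` (generating functions: kernel `cz/(1 − ρz)`, resolvent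
  `(1 − ρz)/(1 − (ρ + c)z)`).
* §2 THE SHARP FORM OF `T4BetaMemory`'s BRIDGE (b), over ITS shapes.  `moduli_geometric_sharp`:
  `ModuliRenewal lam M′ ℓ′` + `FadingMemory C′ ω M′` ⟹ `lam j i ≤ ℓ′ ((1 + C′)ω)^{j−i}` — no smallness, no `ρ`;
  `fadingMemory_of_moduliRenewal_sharp`: with `ModuliDecomposition Λ lam M ℓ`, `FadingMemory C ω M`, `Λ ≥ 0`, `C′ > 0`
  ⟹ `T4CouplingMatching.FadingMemory (ℓ + C ℓ′/C′) ((1 + C′)ω) Λ`.  So the smallness `(1 + C′)ω < 1` — i.e.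
  `C′ < L^{β} − 1` for `ω = L^{−β}`, equivalently `c < 1 − L^{−α}` in the per-unit-volume normalisation — is EXACTLY the
  condition for a useful (`< 1`) rate, and it is decided by ONE number: the one-step transfer constant of the functional
  memory (NOT PRINTED: [II]/[III] print size bounds — [III] (2.43) — not moduli; cell GAPS G-t4-U2R-1…4, G-b12g6-1).
* §2 EXTREMAL DATA for general `ω`.  `moduliRenewal_extremal`: the memory `M′ j m = C′ω^{j−m}` with the moduli `lamE`
  generated by the renewal WITH EQUALITY (`lamE (i+n+1) i = ℓ′ C′ω ((1 + C′)ω)^n`, `lamE_closed_form`) satisfy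
  `FadingMemory C′ ω M′` and `ModuliRenewal lamE M′ ℓ′`; `not_fadingMemory_below`: for `ℓ′, C′, ω > 0` these moduli admit
  NO `FadingMemory D ν′` with `ν′ < (1 + C′)ω` — the general-ω form of `T4BetaMemory.constMemory_witness` (`ω = 1`).
* §2 `remainderShiftRate_of_scaleShiftRate` — converse bookkeeping of `T4CouplingMatching.scaleShiftRate_of_split`
  (full-β rate + the β sub-cell's (AF-0r) ⟹ the β¹-remainder's rate), recorded because the B12-side reading makes the
  FULL β the natural object: β is a LINEAR functional of the new term `E^{(k+1)}` ([I] (4.37) p. 291, (5.10) p. 293,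
  (5.42) p. 297 *"β = … = Σ_x Π_{μν}(x)x_μx_ν … This is the fundamental equality defining the β-function."*), so ANY
  two-run discrepancy of the new term (couplings p vs q, or spacings η vs η/L) bounds the β-discrepancy linearly
  [analysis; record B12-XREAD-HISTORY.md §3].

SCOPE / HONEST LIMITS.  Nothing about Bałaban's construction is asserted; `ModuliRenewal`, `ModuliDecomposition`,
`FadingMemory` are `T4BetaMemory` / `T4CouplingMatching` HYPOTHESIS SHAPES whose instances for the objects of (2.13)
are NOT PRINTED and not claimed.  ℕ-subtraction occurs only in exponents under the matching order hypothesis (true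
differences).  Everything here is `[folklore]` bookkeeping (discrete Volterra equations of convolution type); zero
`sorry`, no new axioms; imports `T4BetaMemory` (hence `T4CouplingMatching`, `FlowStep`, `B12Beta`) and modifies nothing.

References (context; the two quotations above were read by this seat on the ×2 renders
`b2b-balaban-ref1/pages/1987-cmp109-rg-I-small-field/…-p010-x2.png` (p. 258) and `…-p049-x2.png` (p. 297); the
manuscript is UNDER ADJUDICATION and is quoted for what it states): [I] = T. Bałaban, Renormalization group approach to
lattice gauge field theories. I, Commun. Math. Phys. 109 (1987) 249–301 [cite: Balaban1987RG1]; [III] = T. Bałaban,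
Convergent renormalization expansions for lattice gauge theories, Commun. Math. Phys. 119 (1988) 243–285
[cite: Balaban1988Convergent]; K. Gawędzki, A. Kupiainen, Commun. Math. Phys. 102 (1985) 1–30, (142)–(143) p. 20 (the
non-contracting marginal direction; `T4BetaMemory` §2) [cite: GawedzkiKupiainen1985].
-/

namespace Literature.MathematicalPhysics.QuantumFieldTheory.Balaban1983to89.T4BetaMemorySharp

open Finset
open scoped BigOperators
open Literature.MathematicalPhysics.QuantumFieldTheory.Balaban1983to89
open Literature.MathematicalPhysics.QuantumFieldTheory.Balaban1983to89.FlowStep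
open Literature.MathematicalPhysics.QuantumFieldTheory.Balaban1983to89.T4CouplingMatching
  (ScaleShiftRate RemainderShiftRate FadingMemory)
open Literature.MathematicalPhysics.QuantumFieldTheory.Balaban1983to89.T4BetaMemory
  (ModuliDecomposition ModuliRenewal)

/-! ## §1 State form and exact impulse response of the renewal inequality (pure bookkeeping) -/

/-- The ACCUMULATED WEIGHTED CONTENT of a sequence `b` with per-step factor `ρ`: `acc ρ b n = Σ_{m<n} ρ^{n−1−m} b m`
(entry `m` aged `n − 1 − m` steps when seen from step `n`; empty for `n = 0`).  Dictionary: `ρ = L^{−α}`, `b m` the size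
or discrepancy of the term born at step `m` in the units of (1.18) p. 263 of [I]; `acc ρ b n` = the (0.29)/(0.30)-weighted
content, per unit volume, of the old terms present at the step producing the `n`-th term. [folklore] -/
def acc (ρ : ℝ) (b : ℕ → ℝ) (n : ℕ) : ℝ := ∑ m ∈ range n, ρ ^ (n - 1 - m) * b m

/-- No old terms before the first step. [folklore] -/
theorem acc_zero (ρ : ℝ) (b : ℕ → ℝ) : acc ρ b 0 = 0 := by simp [acc]

/-- STATE FORM: one more step ages every old entry by one factor `ρ` and adds the newborn entry with weight `ρ⁰ = 1`
(a newborn term is not yet suppressed: `(L^kη)^α = 1` at `j = k`): `acc ρ b (n+1) = ρ · acc ρ b n + b n`. [folklore] -/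
theorem acc_succ (ρ : ℝ) (b : ℕ → ℝ) (n : ℕ) : acc ρ b (n + 1) = ρ * acc ρ b n + b n := by
  unfold acc
  rw [Finset.sum_range_succ, Finset.mul_sum]
  have h1 : ∀ m ∈ range n, ρ ^ (n + 1 - 1 - m) * b m = ρ * (ρ ^ (n - 1 - m) * b m) := by
    intro m hm
    have hm' : m < n := Finset.mem_range.mp hm
    have he : n + 1 - 1 - m = (n - 1 - m) + 1 := by omega
    rw [he, pow_succ]; ring
  rw [Finset.sum_congr rfl h1]
  simp

/-- RESOLVENT, STATE FORM.  `s 0 ≤ 0`, `s (n+1) ≤ ρ s n + b n`, `b n ≤ f n + c · s n`, `0 ≤ ρ, c` ⟹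
`s n ≤ acc (ρ + c) f n`: the accumulated content is driven by the forcing through the ENLARGED factor `ρ + c` (no sign
condition on `f`, `b`). [folklore] -/
theorem state_le {ρ c : ℝ} {b f s : ℕ → ℝ} (hρ : 0 ≤ ρ) (hc : 0 ≤ c) (hs0 : s 0 ≤ 0)
    (hstep : ∀ n, s (n + 1) ≤ ρ * s n + b n) (hb : ∀ n, b n ≤ f n + c * s n) :
    ∀ n, s n ≤ acc (ρ + c) f n := by
  intro n
  induction n with
  | zero => simpa [acc_zero] using hs0
  | succ n ih =>
    rw [acc_succ]
    have h1 := hstep n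
    have h2 := hb n
    have h3 : (ρ + c) * s n ≤ (ρ + c) * acc (ρ + c) f n := mul_le_mul_of_nonneg_left ih (add_nonneg hρ hc)
    nlinarith

/-- EXACT RESOLVENT of the renewal inequality `b n ≤ f n + c Σ_{m<n} ρ^{n−1−m} b m` (`0 ≤ ρ, c`; no sign condition on
`f`, `b`): `b n ≤ f n + c Σ_{m<n} (ρ + c)^{n−1−m} f m`.  (Kernel `cz/(1 − ρz)`, resolvent `(1 − ρz)/(1 − (ρ + c)z)`;
for geometric forcing `f n = a ν^n`, `ν > ρ + c`, this is `T4BetaMemory.renewal_geometric`'s bound — not re-derived.)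
[folklore] -/
theorem renewal_le {ρ c : ℝ} {b f : ℕ → ℝ} (hρ : 0 ≤ ρ) (hc : 0 ≤ c)
    (hb : ∀ n, b n ≤ f n + c * acc ρ b n) : ∀ n, b n ≤ f n + c * acc (ρ + c) f n := by
  have hs := state_le (s := acc ρ b) hρ hc (by simp [acc_zero]) (fun n => (acc_succ ρ b n).le) hb
  intro n
  have := mul_le_mul_of_nonneg_left (hs n) hc
  linarith [hb n]

/-- EXACT IMPULSE RESPONSE — RATE `ρ + c`, NO SMALLNESS, NO AUXILIARY RATE.  `s 0 ≤ 0`, `s (n+1) ≤ ρ s n + b n`,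
`b 0 ≤ d`, `b (n+1) ≤ c · s (n+1)`, `0 ≤ ρ, c, d` ⟹ `b n ≤ d (ρ + c)^n`.  Dictionary (node U2 (b)): `b n` = the
sensitivity to the coupling `g_i` of the term born `n` steps after `g_i` was used; `d` = the direct sensitivity of the
newborn term to its own last coupling; `c` = the one-step transfer constant of the functional memory (newest old entry);
compare `T4BetaMemory.moduli_geometric` (rate any `ρ' > (1 + C′)ω`, constant `ℓ′(ρ'−ω)(ρ'−(1+C′)ω)⁻¹`). [folklore] -/
theorem impulse_le {ρ c d : ℝ} {b s : ℕ → ℝ} (hρ : 0 ≤ ρ) (hc : 0 ≤ c) (hd : 0 ≤ d) (hs0 : s 0 ≤ 0)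
    (hstep : ∀ n, s (n + 1) ≤ ρ * s n + b n) (hb0 : b 0 ≤ d) (hb : ∀ n, b (n + 1) ≤ c * s (n + 1)) :
    ∀ n, b n ≤ d * (ρ + c) ^ n := by
  have hs : ∀ n, s (n + 1) ≤ d * (ρ + c) ^ n := by
    intro n
    induction n with
    | zero =>
      have h1 := hstep 0
      have h2 : ρ * s 0 ≤ 0 := by nlinarith
      simpa using (h1.trans (by linarith))
    | succ n ih =>
      have h1 := hstep (n + 1)
      have h2 := hb n
      have h3 : ρ * s (n + 1) ≤ ρ * (d * (ρ + c) ^ n) := mul_le_mul_of_nonneg_left ih hρ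
      have h4 : c * s (n + 1) ≤ c * (d * (ρ + c) ^ n) := mul_le_mul_of_nonneg_left ih hc
      calc s (n + 1 + 1) ≤ ρ * s (n + 1) + b (n + 1) := h1
        _ ≤ ρ * (d * (ρ + c) ^ n) + c * (d * (ρ + c) ^ n) := by linarith
        _ = d * (ρ + c) ^ (n + 1) := by ring
  intro n
  cases n with
  | zero => simpa using hb0
  | succ n =>
    have h1 := hb n
    have h2 : c * s (n + 1) ≤ c * (d * (ρ + c) ^ n) := mul_le_mul_of_nonneg_left (hs n) hc
    have h3 : c * (d * (ρ + c) ^ n) ≤ (ρ + c) * (d * (ρ + c) ^ n) :=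
      mul_le_mul_of_nonneg_right (by linarith) (mul_nonneg hd (pow_nonneg (add_nonneg hρ hc) n))
    calc b (n + 1) ≤ c * s (n + 1) := h1
      _ ≤ (ρ + c) * (d * (ρ + c) ^ n) := h2.trans h3
      _ = d * (ρ + c) ^ (n + 1) := by ring

/-- THE RATE `ρ + c` IS ATTAINED.  With EQUALITIES (`s 0 = 0`, `s (n+1) = ρ s n + b n`, `b 0 = d`,
`b (n+1) = c · s (n+1)`): `b (n+1) = c · d · (ρ + c)^n` exactly; so no bookkeeping of this form beats `ρ + c`, and `b`
does not tend to zero when `ρ + c ≥ 1`, `c d > 0`.  FADING MEMORY from a transfer constant `c` and the irrelevance factor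
`ρ = L^{−α}` therefore holds IFF `c < 1 − L^{−α}`; `T4BetaMemory.constMemory_witness` is the case `ρ = 1`. [folklore] -/
theorem impulse_sharp {ρ c d : ℝ} {b s : ℕ → ℝ} (hs0 : s 0 = 0)
    (hstep : ∀ n, s (n + 1) = ρ * s n + b n) (hb0 : b 0 = d) (hb : ∀ n, b (n + 1) = c * s (n + 1)) :
    ∀ n, b (n + 1) = c * d * (ρ + c) ^ n := by
  have hs : ∀ n, s (n + 1) = d * (ρ + c) ^ n := by
    intro n
    induction n with
    | zero => simp [hstep 0, hs0, hb0]
    | succ n ih => rw [hstep (n + 1), hb n, ih]; ring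
  intro n
  rw [hb n, hs n]; ring

/-- The IMPULSE-RESPONSE age profile: `Cg` at age 0, `c · Cg · (ρ + c)^{m−1}` at age `m ≥ 1` (the equality solution of
`impulse_sharp` with `d = Cg`). [folklore] -/
def profile (Cg c ρ : ℝ) (m : ℕ) : ℝ := if m = 0 then Cg else c * Cg * (ρ + c) ^ (m - 1)

/-- The accumulated content of the impulse-response profile is geometric: `acc ρ (profile Cg c ρ) (n+1) = Cg (ρ + c)^n`.
[folklore] -/
theorem acc_profile (Cg c ρ : ℝ) : ∀ n, acc ρ (profile Cg c ρ) (n + 1) = Cg * (ρ + c) ^ n := by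
  intro n
  induction n with
  | zero => simp [acc_succ, acc_zero, profile]
  | succ n ih =>
    rw [acc_succ, ih]
    simp only [profile, Nat.succ_ne_zero, if_false, Nat.add_sub_cancel]
    ring

/-! ## §2 The sharp form of `T4BetaMemory`'s bridge (b), extremal data, and the full-β ⇒ remainder glue -/

/-- SHARP BRACKET MODULI.  Under `T4BetaMemory.ModuliRenewal lam M′ ℓ′` (direct modulus `≤ ℓ′` of the newborn
bracket in its own coupling; older couplings reach bracket `j` only through the brackets `m ∈ [i, j)`) and
`FadingMemory C′ ω M′` (`ℓ′, C′, ω ≥ 0`): `lam j i ≤ ℓ′ ((1 + C′) ω)^{j−i}` for `i ≤ j` — rate exactly `(1 + C′)ω`,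
constant `ℓ′`, NO smallness hypothesis (strong induction on the age; `C′ Σ_{m<n} (1 + C′)^m = (1 + C′)^n − 1`).
Compare `T4BetaMemory.moduli_geometric`. [folklore] -/
theorem moduli_geometric_sharp {lam M' : ℕ → ℕ → ℝ} {ℓ' C' ω : ℝ} (hℓ' : 0 ≤ ℓ') (hC' : 0 ≤ C') (hω : 0 ≤ ω)
    (hM' : FadingMemory C' ω M') (hren : ModuliRenewal lam M' ℓ') :
    ∀ j i, i ≤ j → lam j i ≤ ℓ' * ((1 + C') * ω) ^ (j - i) := by
  -- age-indexed claim for a fixed i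
  suffices h : ∀ i n, lam (i + n) i ≤ ℓ' * ((1 + C') * ω) ^ n by
    intro j i hij
    obtain ⟨n, rfl⟩ := Nat.exists_eq_add_of_le hij
    simpa [Nat.add_sub_cancel_left] using h i n
  intro i n
  induction n using Nat.strong_induction_on with
  | _ n ih =>
    rcases Nat.eq_zero_or_pos n with hn | hn
    · subst hn
      simpa using hren.1 i
    · have h := hren.2 (i + n) i (by omega)
      rw [Finset.sum_Ico_eq_sum_range] at h
      have e : i + n - i = n := by omega
      rw [e] at h
      -- bound each summand: M' (i+n) (i+m) * lam (i+m) i ≤ C' ω^(n-m) * (ℓ' ((1+C')ω)^m) = C' ℓ' ω^n (1+C')^m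
      have hν0 : 0 ≤ (1 + C') * ω := mul_nonneg (by linarith) hω
      have hsum : ∑ m ∈ range n, M' (i + n) (i + m) * lam (i + m) i
          ≤ ∑ m ∈ range n, C' * ℓ' * ω ^ n * (1 + C') ^ m := by
        refine Finset.sum_le_sum fun m hm => ?_
        have hmn : m < n := mem_range.mp hm
        obtain ⟨hM0, hM1⟩ := hM' (i + n) (i + m) (by omega)
        have e2 : i + n - (i + m) = n - m := by omega
        rw [e2] at hM1
        have hb := ih m hmn
        have hb0 : 0 ≤ ℓ' * ((1 + C') * ω) ^ m := mul_nonneg hℓ' (pow_nonneg hν0 m)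
        calc M' (i + n) (i + m) * lam (i + m) i ≤ M' (i + n) (i + m) * (ℓ' * ((1 + C') * ω) ^ m) :=
              mul_le_mul_of_nonneg_left hb hM0
          _ ≤ C' * ω ^ (n - m) * (ℓ' * ((1 + C') * ω) ^ m) := mul_le_mul_of_nonneg_right hM1 hb0
          _ = C' * ℓ' * (ω ^ (n - m) * ω ^ m) * (1 + C') ^ m := by rw [mul_pow]; ring
          _ = C' * ℓ' * ω ^ n * (1 + C') ^ m := by rw [← pow_add, Nat.sub_add_cancel hmn.le]
      have hgeom : ∑ m ∈ range n, C' * ℓ' * ω ^ n * (1 + C') ^ m = ℓ' * ω ^ n * ((1 + C') ^ n - 1) := by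
        rw [← Finset.mul_sum]
        have hg := geom_sum_mul (1 + C') n
        -- hg : (∑ i ∈ range n, (1 + C') ^ i) * (1 + C' - 1) = (1 + C') ^ n - 1
        have hg' : C' * ∑ m ∈ range n, (1 + C') ^ m = (1 + C') ^ n - 1 := by
          rw [mul_comm]; simpa using hg
        calc C' * ℓ' * ω ^ n * ∑ m ∈ range n, (1 + C') ^ m = ℓ' * ω ^ n * (C' * ∑ m ∈ range n, (1 + C') ^ m) := by
              ring
          _ = ℓ' * ω ^ n * ((1 + C') ^ n - 1) := by rw [hg']
      have hωn : 0 ≤ ℓ' * ω ^ n := mul_nonneg hℓ' (pow_nonneg hω n)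
      calc lam (i + n) i ≤ ∑ m ∈ range n, M' (i + n) (i + m) * lam (i + m) i := h
        _ ≤ ℓ' * ω ^ n * ((1 + C') ^ n - 1) := hsum.trans hgeom.le
        _ ≤ ℓ' * ω ^ n * (1 + C') ^ n := by nlinarith
        _ = ℓ' * ((1 + C') * ω) ^ n := by rw [mul_pow]; ring

/-- **SHARP BRIDGE (b).**  `ModuliDecomposition Λ lam M ℓ`, `ModuliRenewal lam M′ ℓ′`, `FadingMemory C ω M`,
`FadingMemory C′ ω M′`, `Λ ≥ 0`, with `ℓ, ℓ′, C, ω ≥ 0` and `C′ > 0` ⟹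
`T4CouplingMatching.FadingMemory (ℓ + C ℓ′ / C′) ((1 + C′) ω) Λ` — rate exactly `(1 + C′)ω`, NO smallness hypothesis
(whether the rate is useful, `(1 + C′)ω < 1`, is then a separate, located question: the size of the one-step transfer
constant `C′` of the functional memory, NOT PRINTED).  With the natural identification `C = C′` (one functional memory
for the β-extraction and for the brackets) the constant is `ℓ + ℓ′`.  Compare `T4BetaMemory.fadingMemory_of_moduliRenewal`.
[folklore] -/
theorem fadingMemory_of_moduliRenewal_sharp {Λ lam M M' : ℕ → ℕ → ℝ} {ℓ ℓ' C C' ω : ℝ}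
    (hℓ : 0 ≤ ℓ) (hℓ' : 0 ≤ ℓ') (hC : 0 ≤ C) (hC' : 0 < C') (hω : 0 ≤ ω)
    (hM : FadingMemory C ω M) (hM' : FadingMemory C' ω M') (hdec : ModuliDecomposition Λ lam M ℓ)
    (hren : ModuliRenewal lam M' ℓ') (hΛ0 : ∀ k i, i ≤ k → 0 ≤ Λ k i) :
    FadingMemory (ℓ + C * ℓ' / C') ((1 + C') * ω) Λ := by
  have hν0 : 0 ≤ (1 + C') * ω := mul_nonneg (by linarith) hω
  have hlam := moduli_geometric_sharp hℓ' hC'.le hω hM' hren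
  intro k i hik
  refine ⟨hΛ0 k i hik, ?_⟩
  obtain ⟨N, rfl⟩ := Nat.exists_eq_add_of_le hik
  have h1 := hdec (i + N) i hik
  -- diagonal term
  have hdiag : (if i = i + N then ℓ else 0) ≤ ℓ * ((1 + C') * ω) ^ N := by
    split_ifs with h
    · have hN : N = 0 := by omega
      subst hN; simp
    · exact mul_nonneg hℓ (pow_nonneg hν0 _)
  -- memory sum
  have hsum : ∑ j ∈ Ico i (i + N), M (i + N) j * lam j i ≤ C * ℓ' / C' * ((1 + C') * ω) ^ N := by
    rw [Finset.sum_Ico_eq_sum_range]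
    have e : i + N - i = N := by omega
    rw [e]
    have step1 : ∑ n ∈ range N, M (i + N) (i + n) * lam (i + n) i ≤ ∑ n ∈ range N, C * ℓ' * ω ^ N * (1 + C') ^ n := by
      refine Finset.sum_le_sum fun n hn => ?_
      have hnN : n < N := mem_range.mp hn
      obtain ⟨hM0, hM1⟩ := hM (i + N) (i + n) (by omega)
      have e2 : i + N - (i + n) = N - n := by omega
      rw [e2] at hM1
      have hb := hlam (i + n) i (by omega)
      rw [Nat.add_sub_cancel_left] at hb
      have hb0 : 0 ≤ ℓ' * ((1 + C') * ω) ^ n := mul_nonneg hℓ' (pow_nonneg hν0 n)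
      calc M (i + N) (i + n) * lam (i + n) i ≤ M (i + N) (i + n) * (ℓ' * ((1 + C') * ω) ^ n) :=
            mul_le_mul_of_nonneg_left hb hM0
        _ ≤ C * ω ^ (N - n) * (ℓ' * ((1 + C') * ω) ^ n) := mul_le_mul_of_nonneg_right hM1 hb0
        _ = C * ℓ' * (ω ^ (N - n) * ω ^ n) * (1 + C') ^ n := by rw [mul_pow]; ring
        _ = C * ℓ' * ω ^ N * (1 + C') ^ n := by rw [← pow_add, Nat.sub_add_cancel hnN.le]
    have hgeom : ∑ n ∈ range N, C * ℓ' * ω ^ N * (1 + C') ^ n = C * ℓ' / C' * ω ^ N * ((1 + C') ^ N - 1) := by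
      rw [← Finset.mul_sum]
      have hg := geom_sum_mul (1 + C') N
      have hg' : C' * ∑ m ∈ range N, (1 + C') ^ m = (1 + C') ^ N - 1 := by
        rw [mul_comm]; simpa using hg
      have hC'ne : C' ≠ 0 := ne_of_gt hC'
      calc C * ℓ' * ω ^ N * ∑ m ∈ range N, (1 + C') ^ m
          = (C * ℓ' / C' * C') * ω ^ N * ∑ m ∈ range N, (1 + C') ^ m := by rw [div_mul_cancel₀ (C * ℓ') hC'ne]
        _ = C * ℓ' / C' * ω ^ N * (C' * ∑ m ∈ range N, (1 + C') ^ m) := by ring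
        _ = C * ℓ' / C' * ω ^ N * ((1 + C') ^ N - 1) := by rw [hg']
    have hK0 : 0 ≤ C * ℓ' / C' * ω ^ N := mul_nonneg (div_nonneg (mul_nonneg hC hℓ') hC'.le) (pow_nonneg hω N)
    calc ∑ n ∈ range N, M (i + N) (i + n) * lam (i + n) i ≤ C * ℓ' / C' * ω ^ N * ((1 + C') ^ N - 1) :=
          step1.trans hgeom.le
      _ ≤ C * ℓ' / C' * ω ^ N * (1 + C') ^ N := by nlinarith
      _ = C * ℓ' / C' * ((1 + C') * ω) ^ N := by rw [mul_pow]; ring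
  have e3 : i + N - i = N := by omega
  rw [e3]
  calc Λ (i + N) i ≤ (if i = i + N then ℓ else 0) + ∑ j ∈ Ico i (i + N), M (i + N) j * lam j i := h1
    _ ≤ ℓ * ((1 + C') * ω) ^ N + C * ℓ' / C' * ((1 + C') * ω) ^ N := add_le_add hdiag hsum
    _ = (ℓ + C * ℓ' / C') * ((1 + C') * ω) ^ N := by ring

/-- EXTREMAL MODULI for a given functional-memory rate: `lamE ℓ′ C′ ω j i = profile ℓ′ (C′ω) ω (j − i)` for `i ≤ j`
(`0` otherwise) — `ℓ′` on the diagonal, `ℓ′ C′ω ((1 + C′)ω)^{j−i−1}` below it. [folklore] -/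
def lamE (ℓ' C' ω : ℝ) (j i : ℕ) : ℝ := if i ≤ j then profile ℓ' (C' * ω) ω (j - i) else 0

/-- Closed form below the diagonal: `lamE ℓ′ C′ ω (i+n+1) i = ℓ′ · C′ω · ((1 + C′)ω)^n`. [folklore] -/
theorem lamE_closed_form (ℓ' C' ω : ℝ) (i n : ℕ) :
    lamE ℓ' C' ω (i + n + 1) i = ℓ' * (C' * ω) * ((1 + C') * ω) ^ n := by
  have hle : i ≤ i + n + 1 := by omega
  have hsub : i + n + 1 - i = n + 1 := by omega
  simp only [lamE, if_pos hle, hsub, profile, Nat.succ_ne_zero, if_false, Nat.add_sub_cancel]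
  ring

/-- **EXTREMAL DATA (general ω).**  The memory `M′ j m = C′ω^{j−m}` and the moduli `lamE ℓ′ C′ ω` satisfy
`FadingMemory C′ ω M′` and `T4BetaMemory.ModuliRenewal (lamE ℓ′ C′ ω) M′ ℓ′` (`C′, ω ≥ 0`, any `ℓ′`; the renewal clause holds
WITH EQUALITY, `acc_profile`).  Hence the rate `(1 + C′)ω` of `moduli_geometric_sharp` is attained
(`lamE_closed_form`, `not_fadingMemory_below`): the general-ω form of `T4BetaMemory.constMemory_witness`. [folklore] -/
theorem moduliRenewal_extremal (ℓ' : ℝ) {C' ω : ℝ} (hC' : 0 ≤ C') (hω : 0 ≤ ω) :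
    FadingMemory C' ω (fun j m => C' * ω ^ (j - m)) ∧ ModuliRenewal (lamE ℓ' C' ω) (fun j m => C' * ω ^ (j - m)) ℓ' := by
  refine ⟨?_, ?_, ?_⟩
  · intro j m _
    exact ⟨mul_nonneg hC' (pow_nonneg hω _), le_rfl⟩
  · intro i
    simp [lamE, profile]
  · intro j i hij
    obtain ⟨n, hn⟩ : ∃ n, j = i + n + 1 := ⟨j - i - 1, by omega⟩
    subst hn
    rw [lamE_closed_form, Finset.sum_Ico_eq_sum_range]
    have e : i + n + 1 - i = n + 1 := by omega
    rw [e]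
    -- RHS = Σ_{m<n+1} C' ω^(n+1-m) * profile ℓ' (C'ω) ω m = C'ω * acc ω (profile …) (n+1) = C'ω * ℓ' (ω + C'ω)^n
    have hterm : ∀ m ∈ range (n + 1),
        C' * ω ^ (i + n + 1 - (i + m)) * lamE ℓ' C' ω (i + m) i
          = C' * ω * (ω ^ (n + 1 - 1 - m) * profile ℓ' (C' * ω) ω m) := by
      intro m hm
      have hmn : m < n + 1 := mem_range.mp hm
      have e1 : i + n + 1 - (i + m) = (n + 1 - 1 - m) + 1 := by omega
      have hle : i ≤ i + m := by omega
      simp only [lamE, if_pos hle, Nat.add_sub_cancel_left, e1, pow_succ]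
      ring
    rw [Finset.sum_congr rfl hterm, ← Finset.mul_sum]
    have hacc : ∑ m ∈ range (n + 1), ω ^ (n + 1 - 1 - m) * profile ℓ' (C' * ω) ω m
        = acc ω (profile ℓ' (C' * ω) ω) (n + 1) := rfl
    rw [hacc, acc_profile]
    exact le_of_eq (by ring)

/-- **NO RATE BELOW `(1 + C′)ω`.**  For `ℓ′, C′, ω > 0` the extremal moduli `lamE ℓ′ C′ ω` admit no
`FadingMemory D ν′` with `0 ≤ ν′ < (1 + C′)ω`, for any constant `D`: the threshold `(1 + C′)ω < 1` of `T4BetaMemory`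
(equivalently `c < 1 − L^{−α}` per unit volume) is exactly what separates fading from non-fading memory in this
bookkeeping. [folklore] -/
theorem not_fadingMemory_below {ℓ' C' ω D ν' : ℝ} (hℓ' : 0 < ℓ') (hC' : 0 < C') (hω : 0 < ω)
    (hν'0 : 0 ≤ ν') (hν' : ν' < (1 + C') * ω) : ¬ FadingMemory D ν' (lamE ℓ' C' ω) := by
  intro hfm
  set ν : ℝ := (1 + C') * ω with hν
  have hνpos : 0 < ν := mul_pos (by linarith) hω
  have hA : 0 < ℓ' * (C' * ω) := mul_pos hℓ' (mul_pos hC' hω)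
  -- the FadingMemory bound on the first subdiagonal column i = 0, age n + 1
  have hbound : ∀ n : ℕ, ℓ' * (C' * ω) * ν ^ n ≤ D * ν' ^ (n + 1) := by
    intro n
    have h := (hfm (0 + n + 1) 0 (by omega)).2
    rw [lamE_closed_form] at h
    simpa [hν] using h
  rcases eq_or_lt_of_le hν'0 with hz | hpos
  · -- ν' = 0: already n = 0 is absurd
    have h0 := hbound 0
    rw [← hz] at h0
    simp at h0
    linarith
  · -- ν' > 0: (ν/ν')^n is unbounded
    have hr : 1 < ν / ν' := (one_lt_div hpos).mpr hν'
    have hD : ∀ n : ℕ, (ν / ν') ^ n ≤ D * ν' / (ℓ' * (C' * ω)) := by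
      intro n
      have h := hbound n
      rw [div_pow, div_le_div_iff₀ (pow_pos hpos n) hA]
      calc ν ^ n * (ℓ' * (C' * ω)) = ℓ' * (C' * ω) * ν ^ n := by ring
        _ ≤ D * ν' ^ (n + 1) := h
        _ = D * ν' * ν' ^ n := by ring
    have ht := tendsto_pow_atTop_atTop_of_one_lt hr
    rcases (Filter.tendsto_atTop.mp ht (D * ν' / (ℓ' * (C' * ω)) + 1)) |>.exists with ⟨n, hn⟩
    linarith [hD n]

/-- FULL-β RATE ⟹ REMAINDER RATE (converse bookkeeping of `T4CouplingMatching.scaleShiftRate_of_split`): if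
`|β⁰_{k+1} − β⁰_∞| ≤ c₀θ^k` for all k (the β sub-cell's (AF-0r), field `conv` of `Beta.Assembly.LimitForm`; `0 ≤ θ ≤ 1`,
`0 ≤ c₀`) and `ScaleShiftRate c θ γ β`, then `RemainderShiftRate S (c + 2c₀) θ γ` for the PRINTED one-loop split `S`
((2.12)–(2.14) p. 268 of [I], tree `B12Beta.OneLoopSplit`).  Recorded because β is linear in the new term ((4.37),
(5.10), (5.42) of [I]), so a two-run bound on the new term bounds the FULL β first. [folklore] -/
theorem remainderShiftRate_of_scaleShiftRate {β : HBeta} (S : B12Beta.OneLoopSplit β) {binf c₀ c θ γ : ℝ}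
    (hθ0 : 0 ≤ θ) (hθ1 : θ ≤ 1) (hc₀ : 0 ≤ c₀)
    (hconv : ∀ k, |S.β0 k - binf| ≤ c₀ * θ ^ k) (h : ScaleShiftRate c θ γ β) :
    RemainderShiftRate S (c + 2 * c₀) θ γ := by
  intro k w hw
  have h1 := hconv (k + 1)
  have h2 := hconv k
  have h3 := h k w hw
  have hθk : θ ^ (k + 1) ≤ θ ^ k := pow_le_pow_of_le_one hθ0 hθ1 (Nat.le_succ k)
  have e1 : S.β1 (k + 1) w - S.β1 k (Fin.tail w)
      = (β (k + 1) w - β k (Fin.tail w)) - ((S.β0 (k + 1) - binf) - (S.β0 k - binf)) := by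
    rw [S.split (k + 1) w, S.split k (Fin.tail w)]; ring
  rw [e1]
  calc |(β (k + 1) w - β k (Fin.tail w)) - ((S.β0 (k + 1) - binf) - (S.β0 k - binf))|
      ≤ |β (k + 1) w - β k (Fin.tail w)| + |(S.β0 (k + 1) - binf) - (S.β0 k - binf)| := abs_sub _ _
    _ ≤ |β (k + 1) w - β k (Fin.tail w)| + (|S.β0 (k + 1) - binf| + |S.β0 k - binf|) :=
        add_le_add le_rfl (abs_sub _ _)
    _ ≤ c * θ ^ k + (c₀ * θ ^ (k + 1) + c₀ * θ ^ k) := add_le_add h3 (add_le_add h1 h2)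
    _ ≤ (c + 2 * c₀) * θ ^ k := by nlinarith [mul_le_mul_of_nonneg_left hθk hc₀]

end Literature.MathematicalPhysics.QuantumFieldTheory.Balaban1983to89.T4BetaMemorySharp
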